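import Summits.ResolutionOfSingularities.ResolutionOfSingularities.Theorems.MarkedTransferCampaignW46PlaneInvariant
import Literature.AlgebraicGeometry.Hironaka2017.ARSchemeSingGluing
import HarnessLib

/-!
# [OURS · L1 W4.6 rung (i-d)] OUR per-point invariant `ι = (μ, ord)` is ZARISKI UPPER SEMICONTINUOUS on surfaces
# (cell res-hironaka, LADDER-RESOLUTION rung L, D-0089; campaign s46, prover res-L1-s46-pv-1; host route MarkedTransfer,
# `--supports stmt-ResolutionOfSingularities-16155`)

HONEST FRAMING. Nothing here is a statement of H. Hironaka's manuscript (2017-03-23, [Hironaka2017]); the invariant is OURS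
(`pointInvariant`, companion module `…PlaneInvariant`). This file adds the third property that makes `ι` a resolution
invariant in the technical sense on surfaces — besides taking values in a well-order (`wellFoundedLT_pointInvariant`) and
dropping at every non-procrastinating permissible step (`planeInvariantDecreases_holds`): it is UPPER SEMICONTINUOUS for the
Zariski topology, so its loci `{ι ≥ c}` are closed (the role semicontinuity of `Inv` plays for the closedness of the strata
swept by the centres; cf. slot W3.1 of this cell for the manuscript's `Inv`). AI-written; weaker than expert review. No
`sorry`; axioms standard.

## Contents

* `looseGermMeasure_eq_zero_of_ringKrullDim_ne_two` — the measure vanishes at local rings of dimension `≠ 2`;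
  `isClosed_singleton_of_ringKrullDim_stalk_eq_two` — on a scheme of dimension `≤ 2` a point with two-dimensional local ring
  is closed; hence `isClosed_setOf_le_looseGermMeasure`: `{y | j ≤ μ(y)}` (`j ≥ 1`) is a finite set of closed points.
* `isClosed_setOf_le_idealOrder_ambient` — `{y | m ≤ ord_y J}` is closed for every `m : ℕ∞` (the tree's closedness of
  `Sing(J, m)` on an ambient datum, `AmbientDatum.isClosed_sing`; empty for `m = ⊤`).
* **`isClosed_setOf_le_pointInvariant`**, **`upperSemicontinuous_pointInvariant`** — for a standard `E` on an ambient scheme of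
  dimension `≤ 2`, every locus `{y | c ≤ ι(A, E, y)}`, `c ∈ ℕ ×ₗ ℕ∞`, is closed; `ι(A, E, ·)` is upper semicontinuous.

## References

* O. Zariski, P. Samuel, Commutative Algebra II (1960), Appendix 5. [ZariskiSamuel1960]
* H. Hironaka, ms. 2017-03-23, Th. 16.6 p.84 — the ROLE context only, not cited as fact. [Hironaka2017]
-/

noncomputable section

set_option linter.dupNamespace false -- mandated namespace of this single-conjunct summit

open CategoryTheory AlgebraicGeometry TopologicalSpace IsLocalRing

namespace Summit.ResolutionOfSingularities.ResolutionOfSingularities.Theorems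

namespace CampaignW46

open Literature.AlgebraicGeometry.Resolution
open Literature.AlgebraicGeometry.Hironaka2017.S02Preliminaries
open Scheme.IdealSheafData

universe u

/-! ## The measure lives on two-dimensional local rings, which are closed points of a surface -/

section Germ

/-- The loose germ measure of an ideal of a local domain whose dimension is not `2` vanishes (the loose tree of such a node
is empty, `looseExitCount_eq_zero_of_ringKrullDim_ne_two`, computed in the fraction field). [folklore] -/
theorem looseGermMeasure_eq_zero_of_ringKrullDim_ne_two {R : Type u} [CommRing R] [IsLocalRing R] [IsDomain R] {b : ℕ}
    (I : Ideal R) (h : ringKrullDim R ≠ 2) : looseGermMeasure R I b = 0 := by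
  rw [looseGermMeasure_eq]
  set ι := algebraMap R (FractionRing R) with hι
  have hinj : Function.Injective ι := IsFractionRing.injective R (FractionRing R)
  have hfrac : ∀ z : FractionRing R, ∃ a c : R, ι c ≠ 0 ∧ z = ι a / ι c := fun z => by
    obtain ⟨a, c, hc, hz⟩ := IsFractionRing.div_surjective (A := R) z
    exact ⟨a, c, IsFractionRing.to_map_ne_zero_of_mem_nonZeroDivisors hc, hz.symm⟩
  rw [germLooseExitCount_eq_looseExitCount ι hinj hfrac]
  refine looseExitCount_eq_zero_of_ringKrullDim_ne_two _ fun h2 => h ?_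
  have hbij : Function.Bijective ι.rangeRestrict :=
    ⟨fun _ _ e => hinj (congrArg Subtype.val e), ι.rangeRestrict_surjective⟩
  rw [ringKrullDim_eq_of_ringEquiv (RingEquiv.ofBijective ι.rangeRestrict hbij)]
  exact h2

end Germ

section Surface

variable {p : ℕ} [Fact p.Prime] {K : Type u} [Field K] [CharP K p]

/-- On a scheme of dimension `≤ 2` a point whose local ring has dimension `2` is a closed point (a strict specialisation
would have codimension `≥ 3`). [folklore] -/
theorem isClosed_singleton_of_ringKrullDim_stalk_eq_two {Z : Scheme.{u}} (hdimZ : topologicalKrullDim Z ≤ 2) {y : Z}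
    (h : ringKrullDim (Z.presheaf.stalk y) = 2) : IsClosed ({y} : Set Z) := by
  have hcoh : Order.coheight y = 2 := by
    have h' : ((Order.coheight y : ℕ∞) : WithBot ℕ∞) = ((2 : ℕ∞) : WithBot ℕ∞) := by
      rw [← ringKrullDim_stalk_eq_coheight]; exact h
    exact WithBot.coe_injective h'
  rw [← closure_subset_iff_isClosed]
  intro x hx
  rw [Set.mem_singleton_iff]
  by_contra hne
  have hsp : y ⤳ x := specializes_iff_mem_closure.mpr hx
  have hlt : x < y := lt_of_le_not_ge (Scheme.le_iff_specializes.mpr hsp) fun h' =>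
    hne (Specializes.antisymm (Scheme.le_iff_specializes.mp h') hsp).eq
  have h1 : Order.coheight y + 1 ≤ Order.coheight x := Order.coheight_add_one_le hlt
  have h2 : ((Order.height x + Order.coheight x : ℕ∞) : WithBot ℕ∞) ≤ 2 :=
    (coe_height_add_coheight_le_topologicalKrullDim x).trans hdimZ
  have h3 : Order.height x + Order.coheight x ≤ 2 := WithBot.coe_le_coe.mp h2
  have h4 : Order.coheight y + 1 ≤ 2 := h1.trans (le_add_self.trans h3)
  rw [hcoh] at h4
  exact absurd h4 (by decide)

/-- A point of an ambient scheme of dimension `≤ 2` at which the loose germ measure of `E` is positive is a closed point.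
[folklore] -/
theorem isClosed_singleton_of_looseGermMeasure_pos (A : AmbientDatum p K) (E : IdealExponent A.Z)
    (hdimZ : topologicalKrullDim A.Z ≤ 2) {y : A.Z}
    (hy : 0 < looseGermMeasure (A.Z.presheaf.stalk y) (stalkIdeal E.J y) E.b) : IsClosed ({y} : Set A.Z) := by
  haveI := ambient_isIntegral A
  refine isClosed_singleton_of_ringKrullDim_stalk_eq_two hdimZ ?_
  by_contra h2
  exact (Nat.pos_iff_ne_zero.mp hy) (looseGermMeasure_eq_zero_of_ringKrullDim_ne_two _ h2)

/-- **The loci `{μ ≥ j}`, `j ≥ 1`, are closed**: finite sets (`finite_setOf_looseGermMeasure_pos`) of closed points.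
[folklore] -/
theorem isClosed_setOf_le_looseGermMeasure (A : AmbientDatum p K) (E : IdealExponent A.Z) (hE : E.IsStandard)
    (hdimZ : topologicalKrullDim A.Z ≤ 2) {j : ℕ} (hj : 1 ≤ j) :
    IsClosed {y : A.Z | j ≤ looseGermMeasure (A.Z.presheaf.stalk y) (stalkIdeal E.J y) E.b} := by
  set S := {y : A.Z | j ≤ looseGermMeasure (A.Z.presheaf.stalk y) (stalkIdeal E.J y) E.b} with hS
  have hsub : S ⊆ {y : A.Z | 0 < looseGermMeasure (A.Z.presheaf.stalk y) (stalkIdeal E.J y) E.b} :=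
    fun y hy => lt_of_lt_of_le (Nat.lt_of_lt_of_le Nat.zero_lt_one hj) hy
  have hfin : S.Finite := (finite_setOf_looseGermMeasure_pos A E hE hdimZ).subset hsub
  rw [← Set.biUnion_of_singleton S]
  exact hfin.isClosed_biUnion fun y hy => isClosed_singleton_of_looseGermMeasure_pos A E hdimZ (hsub hy)

/-- **The loci `{ord ≥ m}` are closed** on an ambient datum, for every `m : ℕ∞` and every non-zero ideal sheaf: for finite
`m` this is the closedness of `Sing(J, m)` (`AmbientDatum.isClosed_sing`, upper semicontinuity of the order); for `m = ⊤`
the locus is empty (`idealOrder_ne_top`). [folklore] -/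
theorem isClosed_setOf_le_idealOrder_ambient (A : AmbientDatum p K) {J : A.Z.IdealSheafData} (hJ : J ≠ ⊥) (m : ℕ∞) :
    IsClosed {y : A.Z | m ≤ idealOrder J y} := by
  haveI := ambient_isIntegral A
  haveI : IsLocallyNoetherian A.Z := ambient_isLocallyNoetherian A
  induction m using ENat.recTopCoe with
  | top =>
    convert isClosed_empty (X := A.Z)
    ext y
    simp only [Set.mem_setOf_eq, top_le_iff, Set.mem_empty_iff_false, iff_false]
    exact idealOrder_ne_top hJ y
  | coe m => exact A.isClosed_sing ⟨J, m⟩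

/-- [OURS · L1 W4.6 rung (i-d)] NOT a statement of the manuscript. **The loci `{y | c ≤ ι(A, E, y)}` of OUR invariant are
CLOSED** for every `c ∈ ℕ ×ₗ ℕ∞`, `E` standard on an ambient scheme of dimension `≤ 2`: with `c = (k, m)`,
`{ι ≥ c} = {μ ≥ k + 1} ∪ ({μ ≥ k} ∩ {ord ≥ m})`. [folklore] -/
theorem isClosed_setOf_le_pointInvariant (A : AmbientDatum p K) (E : IdealExponent A.Z) (hE : E.IsStandard)
    (hdimZ : topologicalKrullDim A.Z ≤ 2) (c : ℕ ×ₗ ℕ∞) : IsClosed {y : A.Z | c ≤ pointInvariant A E y} := by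
  set μ : A.Z → ℕ := fun y => looseGermMeasure (A.Z.presheaf.stalk y) (stalkIdeal E.J y) E.b with hμ
  obtain ⟨k, m⟩ := c
  have hset : {y : A.Z | (toLex (k, m) : ℕ ×ₗ ℕ∞) ≤ pointInvariant A E y} =
      {y | k + 1 ≤ μ y} ∪ ({y | k ≤ μ y} ∩ {y | m ≤ idealOrder E.J y}) := by
    ext y
    simp only [pointInvariant, Set.mem_setOf_eq, Prod.Lex.toLex_le_toLex, Set.mem_union, Set.mem_inter_iff]
    constructor
    · rintro (h | ⟨h1, h2⟩)
      · exact Or.inl h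
      · exact Or.inr ⟨h1.le, h2⟩
    · rintro (h | ⟨h1, h2⟩)
      · exact Or.inl h
      · rcases h1.lt_or_eq with h1 | h1
        · exact Or.inl h1
        · exact Or.inr ⟨h1, h2⟩
  change IsClosed {y : A.Z | (toLex (k, m) : ℕ ×ₗ ℕ∞) ≤ pointInvariant A E y}
  rw [hset]
  refine (isClosed_setOf_le_looseGermMeasure A E hE hdimZ (Nat.le_add_left 1 k)).union (IsClosed.inter ?_ ?_)
  · rcases Nat.eq_zero_or_pos k with hk | hk
    · subst hk
      convert isClosed_univ (X := A.Z)
      ext y; simp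
    · exact isClosed_setOf_le_looseGermMeasure A E hE hdimZ hk
  · exact isClosed_setOf_le_idealOrder_ambient A hE.1 m

/-- [OURS · L1 W4.6 rung (i-d)] NOT a statement of the manuscript. **OUR invariant is upper semicontinuous** for the Zariski
topology on an ambient scheme of dimension `≤ 2` (standard `E`). [folklore] -/
theorem upperSemicontinuous_pointInvariant (A : AmbientDatum p K) (E : IdealExponent A.Z) (hE : E.IsStandard)
    (hdimZ : topologicalKrullDim A.Z ≤ 2) : UpperSemicontinuous (pointInvariant A E) :=
  upperSemicontinuous_iff_isClosed_preimage.mpr fun c => isClosed_setOf_le_pointInvariant A E hE hdimZ c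

end Surface

end CampaignW46

end Summit.ResolutionOfSingularities.ResolutionOfSingularities.Theorems

end
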